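import Summits.FinalStateConjecture.FinalStateConjecture.Theorems.ZeroEnergyKerrOrBombStationaryLimitReductionRecutCoveringJunctionCore
import Summits.FinalStateConjecture.FinalStateConjecture.Theorems.BartnikGapSettlingGapExhaustionChartSegmentChronological
import Literature.Geometry.Lorentzian.BackgroundChartCalculus
import Literature.Geometry.Lorentzian.MinkowskiGlobalHyperbolicity
import HarnessLib

/-!
# Route ZeroEnergyKerrOrBomb · crux `FinalStateFromKerrOrBomb` (stmt-FinalStateConjecture-17839), line
# `SketchIdeator1` — stub `stub_recutJunctionCoreOriented`, wave 4: the FLAT TIME LINES of the radiation zone are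
# eventually future timelike; a flat point whose vertical segment up to flat time `τ₁` stays in the flat domain lies
# in `J⁻` of the flat slab `{x⁰ = τ₁}`, hence of every recut / d.o.c. certified slab at `τ₁`

Helper file (`--supports stmt-FinalStateConjecture-17839`; registered helper `recutJunction_flatTimeLine_slab`) of the
lead's wave-4 stub worker W15 (2026-08-17), companion of the wave-3 files `…RecutJunctionHoleTube.lean` (p141608, the
Kerr–Schild time lines of the certified HOLE tubes), `…RecutJunctionPastBoundary.lean` (p141631) and
`…RecutJunctionSlabCrossing.lean` (p142043).

This is the flat-zone steering brick (step (i) of the past-boundary / junction programme; W15 report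
`work/stubs/W15-report.md`): no chart-overlap clause and no hole enters. For a chart `ψ` on an open `U ⊆ E4` which is
smooth, whose full `Cᵏ` deviation from `η` on the flat slabs `{x⁰ = τ} ∩ U` tends to `0`, and which satisfies the
orientation clause (iii) of `IsOrientationCompatible` after `τ₀` (where `dψ(∂₀)` is timelike at a late point it is
future-directed), there is a flat time `τF > τ₀` such that every vertical coordinate segment
`{y + s e₀ : 0 ≤ s ≤ S} ⊆ U` starting at flat time `y⁰ ≥ τF` is carried by `ψ` to a future-directed timelike curve:
`g(dψ e₀, dψ e₀) ≤ η(e₀, e₀) + ½ = −½` by `C⁰` pinching (§1), future by (iii), and the tree's chart-segment glue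
`stub_chartSegment_chronological` through the parametrisation `ψ ∘ (chartAt E4 y)⁻¹` (§2,
`flatTimeLine_mem_chronologicalFuture`). §3 specialises to a stationary decomposition `d`: with `S = τ₁ − y⁰` the
endpoint is a point of the flat slab `Ψ₀({x⁰ = τ₁} ∩ U₀)`, a piece of `recutCertifiedSlab d M a Θ R' τ₁` for ALL
`M a Θ R'` and of `docCertifiedSlab d R τ₁` for all `R` (`recutJunction_flatTimeLine_slab`,
`recutJunction_flatTimeLine_docSlab`).

Elementary; no named fact, nothing restated. References: O'Neill 1983, Ch. 5, Lemma 5.29 (timecones), Ch. 14,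
pp. 402–403 (`I⁺`, `J⁻`); Dafermos–Luk arXiv:1710.01722, Conjecture 1 (b)–(c) (late-time chart bookkeeping).
-/

set_option linter.dupNamespace false

noncomputable section

open scoped Manifold ContDiff Topology ENNReal
open Set Filter Function Literature.Geometry.Lorentzian

namespace Summit.FinalStateConjecture.FinalStateConjecture.Theorems.SymplecticDualOfTheBomb

open Summit.FinalStateConjecture.FinalStateConjecture.Theorems.OneLockedExplosion

/-! ## §1 Pointwise `C⁰` control on a full slab -/

section Prelim

variable (𝓢 : Spacetime.{0} 4)

/-- Private copy of `val_mfderiv_le_of_truncDeviationCk_lt` (skeleton `SketchIdeator1` §3 / `…ChartTransferT2.lean`,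
p136225, unbuilt today): if the `Cᵏ` deviation of `ψ^* g` from `g₀` on the truncated slab `{t = τ, r ≤ R}` is `< ε`,
then at every point of that slab `g(dψ w, dψ w) ≤ g₀(x)(w, w) + ε ‖w‖²`. [folklore] -/
private theorem val_mfderiv_le_of_truncDeviationCk_lt_w4 (B : ModelBackground) (ψ : B.domain → 𝓢.carrier) {k : ℕ}
    {R τ ε : ℝ} (hε : 0 < ε) (h : 𝓢.truncDeviationCk B ψ k R τ < ENNReal.ofReal ε) {x : B.domain}
    (hx : x ∈ B.truncTimeSlab R τ) (w : E4) :
    𝓢.metric.val (ψ x) (mfderiv 𝓘(ℝ, E4) (𝓡 4) ψ x w) (mfderiv 𝓘(ℝ, E4) (𝓡 4) ψ x w) ≤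
      B.bilin x.1 w w + ε * (‖w‖ * ‖w‖) := by
  have h1 : ‖𝓢.deviation B ψ x‖ < ε := by
    have h2 := enorm_iteratedFDeriv_le_supCkENorm (Nat.zero_le k) (mem_image_of_mem Subtype.val hx)
      (𝓢.deviationExtend B ψ)
    rw [← ofReal_norm, norm_iteratedFDeriv_zero, 𝓢.deviationExtend_coe] at h2
    exact (ENNReal.ofReal_lt_ofReal_iff hε).1 (h2.trans_lt h)
  have h3 : |𝓢.deviation B ψ x w w| ≤ ‖𝓢.deviation B ψ x‖ * ‖w‖ * ‖w‖ := by
    rw [← Real.norm_eq_abs]; exact (𝓢.deviation B ψ x).le_opNorm₂ w w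
  have h4 := 𝓢.deviation_apply B ψ x w w
  have h6 : ‖𝓢.deviation B ψ x‖ * ‖w‖ * ‖w‖ ≤ ε * (‖w‖ * ‖w‖) := by
    rw [mul_assoc]; exact mul_le_mul_of_nonneg_right h1.le (mul_nonneg (norm_nonneg w) (norm_nonneg w))
  linarith [(abs_le.1 h3).2]

/-- **Full flat slabs**: if the `Cᵏ` deviation of `ψ^* g` from `η` on the flat slab `{x⁰ = τ} ∩ U` is `< ½`, then at
every point of that slab `dψ(∂₀)` is timelike, `g(dψ e₀, dψ e₀) ≤ −½ < 0` (`η(e₀, e₀) = −1`, `‖e₀‖ = 1`). [folklore] -/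
theorem isTimelike_flat_of_deviationCk_lt {U : TopologicalSpace.Opens E4}
    (ψ : (Minkowski.backgroundOn U).domain → 𝓢.carrier) {k : ℕ} {τ : ℝ}
    (h : 𝓢.deviationCk (Minkowski.backgroundOn U) ψ k τ < ENNReal.ofReal (1 / 2))
    {y : (Minkowski.backgroundOn U).domain} (hy : y ∈ (Minkowski.backgroundOn U).timeSlab τ) :
    𝓢.metric.IsTimelike (mfderiv 𝓘(ℝ, E4) (𝓡 4) ψ y (E4.basisVector 0)) := by
  have hε : (0 : ℝ) < 1 / 2 := by norm_num
  have hy' : y ∈ (Minkowski.backgroundOn U).truncTimeSlab ((Minkowski.backgroundOn U).radius y.1) τ := ⟨hy, le_rfl⟩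
  have h2 := val_mfderiv_le_of_truncDeviationCk_lt_w4 𝓢 (Minkowski.backgroundOn U) ψ hε
    ((𝓢.truncDeviationCk_le_deviationCk (Minkowski.backgroundOn U) ψ k _ τ).trans_lt h) hy' (E4.basisVector 0)
  have h3 : (Minkowski.backgroundOn U).bilin y.1 (E4.basisVector 0) (E4.basisVector 0) = -1 :=
    Minkowski.bilin_basisVector_zero
  have h4 : ‖E4.basisVector 0‖ = 1 := by simp [E4.basisVector]
  rw [h3, h4] at h2
  exact h2.trans_lt (by norm_num)

end Prelim

/-! ## §2 Vertical flat segments are future timelike chart segments -/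

section Line

variable (𝓢 : Spacetime.{0} 4)

/-- **Flat time lines are eventually future timelike.** Let `ψ` be a smooth chart on the open `U ⊆ E4` whose full `Cᵏ`
deviation from `η` on the flat slabs tends to `0`, and assume the orientation clause (iii) after `τ₀` (a timelike
`dψ(∂₀)` at a point of flat time `> τ₀` is future-directed). Then there is `τF > τ₀` such that for every coordinate
point `y` of flat time `y⁰ ≥ τF`, every `S > 0` and every vertical segment `{y + s e₀ : 0 ≤ s ≤ S} ⊆ U`, the chart
point of `y + S e₀` lies in the CHRONOLOGICAL future of the chart point of `y`: the segment is a chart segment with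
timelike (§1) future (clause (iii)) velocity `dψ e₀`, glued by `stub_chartSegment_chronological`.
O'Neill 1983, Ch. 14, pp. 402–403. [folklore] -/
theorem flatTimeLine_mem_chronologicalFuture {U : TopologicalSpace.Opens E4}
    (ψ : (Minkowski.backgroundOn U).domain → 𝓢.carrier) (hψ : ContMDiff 𝓘(ℝ, E4) (𝓡 4) ∞ ψ) {k : ℕ}
    (hdev : Tendsto (fun τ ↦ 𝓢.deviationCk (Minkowski.backgroundOn U) ψ k τ) atTop (𝓝 0)) {τ₀ : ℝ}
    (hor : ∀ y : (Minkowski.backgroundOn U).domain, τ₀ < (y : E4) 0 →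
      𝓢.metric.IsTimelike (mfderiv 𝓘(ℝ, E4) (𝓡 4) ψ y (E4.basisVector 0)) →
        𝓢.timeOrientation.IsFutureDirected (mfderiv 𝓘(ℝ, E4) (𝓡 4) ψ y (E4.basisVector 0))) :
    ∃ τF : ℝ, τ₀ < τF ∧ ∀ (y : E4) (S : ℝ), τF ≤ y 0 → 0 < S →
      (∀ s ∈ Icc (0 : ℝ) S, y + s • E4.basisVector 0 ∈ (U : Set E4)) →
      ∀ (h₀ : y ∈ (U : Set E4)) (h₁ : y + S • E4.basisVector 0 ∈ (U : Set E4)),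
        ψ ⟨y + S • E4.basisVector 0, h₁⟩ ∈ 𝓢.metric.chronologicalFuture 𝓢.timeOrientation {ψ ⟨y, h₀⟩} := by
  have hε : (0 : ℝ) < 1 / 2 := by norm_num
  obtain ⟨T, hT⟩ := Filter.eventually_atTop.1 (hdev.eventually (gt_mem_nhds (ENNReal.ofReal_pos.2 hε)))
  refine ⟨max T τ₀ + 1, by linarith [le_max_right T τ₀], fun y S hy hS hseg h₀ h₁ ↦ ?_⟩
  set v : E4 := E4.basisVector 0 with hv
  -- flat time along the segment
  have htime : ∀ s : ℝ, (y + s • v) 0 = y 0 + s := fun s ↦ by simp [hv, E4.basisVector]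
  have hTs : ∀ s : ℝ, 0 ≤ s → T ≤ (y + s • v) 0 := fun s hs ↦ by
    rw [htime]; linarith [le_max_left T τ₀]
  have hτ₀s : ∀ s : ℝ, 0 ≤ s → τ₀ < (y + s • v) 0 := fun s hs ↦ by
    rw [htime]; linarith [le_max_right T τ₀]
  -- pointwise along the segment: timelike (pinching) and future (clause (iii))
  have htl : ∀ s (hs : s ∈ Icc (0 : ℝ) S),
      𝓢.metric.IsTimelike (mfderiv 𝓘(ℝ, E4) (𝓡 4) ψ ⟨y + s • v, hseg s hs⟩ v) := fun s hs ↦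
    isTimelike_flat_of_deviationCk_lt 𝓢 ψ (hT _ (hTs s hs.1)) (show (y + s • v) 0 = (y + s • v) 0 from rfl)
  have hfut : ∀ s (hs : s ∈ Icc (0 : ℝ) S),
      𝓢.timeOrientation.IsFutureDirected (mfderiv 𝓘(ℝ, E4) (𝓡 4) ψ ⟨y + s • v, hseg s hs⟩ v) := fun s hs ↦
    hor ⟨y + s • v, hseg s hs⟩ (hτ₀s s hs.1) (htl s hs)
  -- the chart-segment glue through the parametrisation `ψ ∘ (chartAt E4 y₀).symm`
  set y₀ : (Minkowski.backgroundOn U).domain := ⟨y, h₀⟩ with hy₀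
  set Φ : E4 → 𝓢.carrier := ψ ∘ (chartAt E4 y₀).symm with hΦ
  have hΦq : ∀ (q : E4) (hq : q ∈ ((Minkowski.backgroundOn U).domain : Set E4)), Φ q = ψ ⟨q, hq⟩ := fun q hq ↦
    congrFun (Spacetime.comp_chartAt_symm_comp_subtypeVal ψ y₀) ⟨q, hq⟩
  have hmd : ∀ s (hs : s ∈ Icc (0 : ℝ) S), MDifferentiableAt 𝓘(ℝ, E4) (𝓡 4) ψ ⟨y + s • v, hseg s hs⟩ := fun s _ ↦
    hψ.mdifferentiableAt (by simp)
  have hI := stub_chartSegment_chronological 𝓢 Φ ((Minkowski.backgroundOn U).domain : Set E4) y v S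
    (Minkowski.backgroundOn U).domain.isOpen (𝓢.contMDiffOn_comp_chartAt_symm (Minkowski.backgroundOn U) ψ y₀ hψ)
    hS (fun s hs ↦ hseg s hs)
    (fun s hs ↦ by
      rw [𝓢.metricInCoords_comp_chartAt_symm_apply (Minkowski.backgroundOn U) ψ y₀ (hseg s hs) (hmd s hs)]
      exact htl s hs)
    (fun s hs ↦ by
      rw [𝓢.mfderiv_comp_chartAt_symm_apply (Minkowski.backgroundOn U) ψ y₀ (hseg s hs) (hmd s hs),
        hΦq _ (hseg s hs)]
      exact hfut s hs)
  rw [hΦq (y + S • v) h₁, hΦq y h₀] at hI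
  exact hI

/-- **Causal form.** Under the same hypotheses, for `S ≥ 0` the chart point of `y` lies in the causal past of the
chart point of `y + S e₀` (for `S = 0` the two points coincide). [folklore] -/
theorem flatTimeLine_mem_causalPast {U : TopologicalSpace.Opens E4}
    (ψ : (Minkowski.backgroundOn U).domain → 𝓢.carrier) (hψ : ContMDiff 𝓘(ℝ, E4) (𝓡 4) ∞ ψ) {k : ℕ}
    (hdev : Tendsto (fun τ ↦ 𝓢.deviationCk (Minkowski.backgroundOn U) ψ k τ) atTop (𝓝 0)) {τ₀ : ℝ}
    (hor : ∀ y : (Minkowski.backgroundOn U).domain, τ₀ < (y : E4) 0 →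
      𝓢.metric.IsTimelike (mfderiv 𝓘(ℝ, E4) (𝓡 4) ψ y (E4.basisVector 0)) →
        𝓢.timeOrientation.IsFutureDirected (mfderiv 𝓘(ℝ, E4) (𝓡 4) ψ y (E4.basisVector 0))) :
    ∃ τF : ℝ, τ₀ < τF ∧ ∀ (y : E4) (S : ℝ), τF ≤ y 0 → 0 ≤ S →
      (∀ s ∈ Icc (0 : ℝ) S, y + s • E4.basisVector 0 ∈ (U : Set E4)) →
      ∀ (h₀ : y ∈ (U : Set E4)) (h₁ : y + S • E4.basisVector 0 ∈ (U : Set E4)),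
        ψ ⟨y, h₀⟩ ∈ 𝓢.metric.causalPast 𝓢.timeOrientation {ψ ⟨y + S • E4.basisVector 0, h₁⟩} := by
  obtain ⟨τF, hτF, h⟩ := flatTimeLine_mem_chronologicalFuture 𝓢 ψ hψ hdev hor
  refine ⟨τF, hτF, fun y S hy hS hseg h₀ h₁ ↦ ?_⟩
  rcases hS.eq_or_lt with rfl | hS'
  · have hpt : (⟨y + (0 : ℝ) • E4.basisVector 0, h₁⟩ : (Minkowski.backgroundOn U).domain) = ⟨y, h₀⟩ := by
      apply Subtype.ext; simp
    rw [hpt]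
    exact LorentzianMetric.subset_causalPast _ _ _ (mem_singleton _)
  · exact LorentzianMetric.mem_causalPast_of_mem_causalFuture
      (LorentzianMetric.chronologicalFuture_subset_causalFuture _ _ _ (h y S hy hS' hseg h₀ h₁))

end Line

/-! ## §3 The decomposition: flat points below the flat slab at `τ₁` -/

section Decomposition

variable {𝓢 : Spacetime.{0} 4} {O : Set 𝓢.carrier} {k : ℕ}

/-- **The flat slab form (all slab families at once).** For a stationary decomposition `d` satisfying the orientation
clause (iii) there is `τF > τ₀` such that: a flat point `Ψ₀ y` of flat time `τF ≤ y⁰ ≤ τ₁` whose vertical coordinate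
segment up to flat time `τ₁` stays in the flat domain lies in `J⁻(Ψ₀({x⁰ = τ₁} ∩ U₀))`. [folklore] -/
theorem flatTimeLine_mem_causalPast_flatSlab (d : StationaryFinalStateDecomposition 𝓢 O k)
    (hor : ∀ y : d.toOver.flatDomain, d.toOver.τ₀ < (y : E4) 0 →
      𝓢.metric.IsTimelike (mfderiv 𝓘(ℝ, E4) (𝓡 4) d.toOver.flatChart y (E4.basisVector 0)) →
        𝓢.timeOrientation.IsFutureDirected (mfderiv 𝓘(ℝ, E4) (𝓡 4) d.toOver.flatChart y (E4.basisVector 0))) :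
    ∃ τF : ℝ, d.toOver.τ₀ < τF ∧ ∀ (τ₁ : ℝ) (y : d.toOver.flatDomain), τF ≤ (y : E4) 0 → (y : E4) 0 ≤ τ₁ →
      (∀ s ∈ Icc (0 : ℝ) (τ₁ - (y : E4) 0), (y : E4) + s • E4.basisVector 0 ∈ (d.toOver.flatDomain : Set E4)) →
      d.toOver.flatChart y ∈ 𝓢.metric.causalPast 𝓢.timeOrientation
        (d.toOver.flatChart '' (Minkowski.backgroundOn d.toOver.flatDomain).timeSlab τ₁) := by
  obtain ⟨τF, hτF, h⟩ := flatTimeLine_mem_causalPast 𝓢 (U := d.toOver.flatDomain) d.toOver.flatChart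
    d.toOver.isLateChart_flat.contMDiff (k := k) d.toOver.tendsto_deviationCk_flat hor
  refine ⟨τF, hτF, fun τ₁ y hy hyτ hseg ↦ ?_⟩
  have hS : 0 ≤ τ₁ - (y : E4) 0 := sub_nonneg.2 hyτ
  have h₁ : (y : E4) + (τ₁ - (y : E4) 0) • E4.basisVector 0 ∈ (d.toOver.flatDomain : Set E4) :=
    hseg _ ⟨hS, le_rfl⟩
  have hend : d.toOver.flatChart ⟨(y : E4) + (τ₁ - (y : E4) 0) • E4.basisVector 0, h₁⟩ ∈
      d.toOver.flatChart '' (Minkowski.backgroundOn d.toOver.flatDomain).timeSlab τ₁ := by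
    refine mem_image_of_mem _ ?_
    show ((y : E4) + (τ₁ - (y : E4) 0) • E4.basisVector 0) 0 = τ₁
    simp [E4.basisVector]
  have hy' := h (y : E4) (τ₁ - (y : E4) 0) hy hS hseg y.2 h₁
  exact LorentzianMetric.causalFuture_mono (singleton_subset_iff.2 hend) hy'

/-- **Registered helper `recutJunction_flatTimeLine_slab` (stub `stub_recutJunctionCoreOriented`, flat steering).** For
a stationary decomposition `d` satisfying the orientation clause (iii) of `IsOrientationCompatible` there is a flat
time `τF > τ₀` such that for ALL parameters `M a`, identifications `Θ`, radii `R'` and chart times `τ₁`: a flat point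
`Ψ₀ y` with `τF ≤ y⁰ ≤ τ₁` whose vertical coordinate segment `{y + s e₀ : 0 ≤ s ≤ τ₁ − y⁰}` stays in the flat domain
lies in `J⁻(recutCertifiedSlab d M a Θ R' τ₁)` (through its flat piece `Ψ₀({x⁰ = τ₁} ∩ U₀)`). [folklore] -/
theorem recutJunction_flatTimeLine_slab : ∀ {𝓢 : Spacetime.{0} 4} {O : Set 𝓢.carrier} {k : ℕ} (d : StationaryFinalStateDecomposition 𝓢 O k), (∀ y : d.toOver.flatDomain, d.toOver.τ₀ < (y : E4) 0 → 𝓢.metric.IsTimelike (mfderiv 𝓘(ℝ, E4) (𝓡 4) d.toOver.flatChart y (E4.basisVector 0)) → 𝓢.timeOrientation.IsFutureDirected (mfderiv 𝓘(ℝ, E4) (𝓡 4) d.toOver.flatChart y (E4.basisVector 0))) → ∃ τF : ℝ, d.toOver.τ₀ < τF ∧ ∀ (M a : Fin d.N → ℝ) (Θ : Fin d.N → E4 → E4) (R' : Fin d.N → ℝ → ℝ) (τ₁ : ℝ) (y : d.toOver.flatDomain), τF ≤ (y : E4) 0 → (y : E4) 0 ≤ τ₁ → (∀ s ∈ Set.Icc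 (0 : ℝ) (τ₁ - (y : E4) 0), (y : E4) + s • E4.basisVector 0 ∈ (d.toOver.flatDomain : Set E4)) → d.toOver.flatChart y ∈ 𝓢.metric.causalPast 𝓢.timeOrientation (recutCertifiedSlab d M a Θ R' τ₁) := by
  intro 𝓢 O k d hor
  obtain ⟨τF, hτF, h⟩ := flatTimeLine_mem_causalPast_flatSlab d hor
  exact ⟨τF, hτF, fun M a Θ R' τ₁ y hy hyτ hseg ↦
    LorentzianMetric.causalFuture_mono subset_union_left (h τ₁ y hy hyτ hseg)⟩

/-- **The d.o.c. slab form.** With the same `τF`, such a flat point lies in `J⁻(docCertifiedSlab d R τ₁)` for all radii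
`R` (through the same flat piece) — the form in which clause (ii) of `HasExhaustiveDocCharts'` states exhaustiveness.
[folklore] -/
theorem recutJunction_flatTimeLine_docSlab (d : StationaryFinalStateDecomposition 𝓢 O k)
    (hor : ∀ y : d.toOver.flatDomain, d.toOver.τ₀ < (y : E4) 0 →
      𝓢.metric.IsTimelike (mfderiv 𝓘(ℝ, E4) (𝓡 4) d.toOver.flatChart y (E4.basisVector 0)) →
        𝓢.timeOrientation.IsFutureDirected (mfderiv 𝓘(ℝ, E4) (𝓡 4) d.toOver.flatChart y (E4.basisVector 0))) :
    ∃ τF : ℝ, d.toOver.τ₀ < τF ∧ ∀ (R : Fin d.N → ℝ → ℝ) (τ₁ : ℝ) (y : d.toOver.flatDomain), τF ≤ (y : E4) 0 →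
      (y : E4) 0 ≤ τ₁ →
      (∀ s ∈ Icc (0 : ℝ) (τ₁ - (y : E4) 0), (y : E4) + s • E4.basisVector 0 ∈ (d.toOver.flatDomain : Set E4)) →
      d.toOver.flatChart y ∈ 𝓢.metric.causalPast 𝓢.timeOrientation (docCertifiedSlab d R τ₁) := by
  obtain ⟨τF, hτF, h⟩ := flatTimeLine_mem_causalPast_flatSlab d hor
  exact ⟨τF, hτF, fun R τ₁ y hy hyτ hseg ↦
    LorentzianMetric.causalFuture_mono subset_union_left (h τ₁ y hy hyτ hseg)⟩

end Decomposition

end Summit.FinalStateConjecture.FinalStateConjecture.Theorems.SymplecticDualOfTheBomb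

end
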